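import Literature.Topology.FourManifolds.LinkingNumberWellDefined
import Literature.Topology.FourManifolds.DehnSurgeryFramingUniqueness
import HarnessLib

/-!
# The linking number of two disjoint knots in `S³` is well defined: discharge

Sibling file of `LinkingNumber.lean` / `LinkingNumberWellDefined.lean` (trunk T-4MAN; D-0014
provefact). `LinkingNumberWellDefined.lean` reduced the named fact
`Literature.Topology.FourManifolds.Knot.existsUnique_hasLinkingNumber` (Rolfsen, *Knots and Links* (1976), §5.D: the linking
number `lk(K, J)` of two disjoint oriented knots in `S³` is a well-defined integer) to the named
fact `Literature.Topology.FourManifolds.Knot.TubularNbhd.zpow_meridian_injective` (the meridian has infinite order in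
`H₁(S³ ∖ K)`; Crowell–Fox (1963), Ch. VIII (1.2)), and `DehnSurgeryFramingUniqueness.lean` proves
that fact (`Knot.TubularNbhd.zpow_meridian_injective_holds`, by the degree-one Hurewicz map and
Mayer–Vietoris). This file records the resulting discharge

* `Literature.Knot.existsUnique_hasLinkingNumber_holds : Knot.existsUnique_hasLinkingNumber`.

No `sorry`; the theorem depends only on `propext`, `Classical.choice`, `Quot.sound`.

## References

* D. Rolfsen, *Knots and Links*, Publish or Perish (1976), §5.D [Rolfsen1976].
* R. H. Crowell, R. H. Fox, *Introduction to Knot Theory* (1963; GTM 57, 1977), Ch. VIII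
  (1.1)–(1.2) [CrowellFox1963].
-/

namespace Literature.Topology.FourManifolds

/-- **The linking number is well defined, proved**: the named fact
`Knot.existsUnique_hasLinkingNumber` of `LinkingNumber.lean` (Rolfsen, *Knots and Links* (1976),
§5.D, definition (2): for disjoint oriented knots `K`, `J` in `S³` there is a unique `l : ℤ` with
`lk(K, J) = l`) holds, by `Knot.existsUnique_hasLinkingNumber_of` (existence: the knot group is
normally generated by the meridian; uniqueness: oriented meridians of any two oriented tubular
neighbourhoods are freely homotopic) and `Knot.TubularNbhd.zpow_meridian_injective_holds` (the
meridian has infinite order in `H₁(S³ ∖ K)`). [cite: Rolfsen1976, §5.D] -/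
theorem Knot.existsUnique_hasLinkingNumber_holds : Knot.existsUnique_hasLinkingNumber :=
  Knot.existsUnique_hasLinkingNumber_of Knot.TubularNbhd.zpow_meridian_injective_holds

end Literature.Topology.FourManifolds
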